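import Mathlib
import Summits.PneNP.PneNP.Theorems.OverlapGapAlgebraSearchHardWindowSequentialLocalReach
import Summits.PneNP.PneNP.Theorems.OverlapGapAlgebraSearchHardWindowSequentialLocalLens

/-!
# PneNP / OverlapGapAlgebra — `SearchHardWindow` / `SolvableImpliesStableSection`:
# SEQUENTIAL LOCAL RULES are ℓ²-stable (2/4, part b) — the pieces of the cone recursion

Support for cruxes `stmt-PneNP-2460` and `stmt-PneNP-2463` (the sequential local rung). For an
instance `Φ` of `F_k(n, m)` and a root `v`, the INCREASING CONE of `v` (within the allowed
clause set `A`) is the set of variables reached from `v` by chains of co-occurring variables with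
increasing labels; `T_A(Φ, v)` denotes its size (written out as a `Finset.card`, no definition).
This file assembles the ingredients of the second-moment recursion
`∑_Φ T(Φ,v)² ≤ N(1 + β) + (β(1 + k² + β)/n) ∑_{u > v} ∑_Φ T(Φ,u)²`, `β = mk²/n` (file 2/4 c):

* `shwSeq_T_le_one_add_sum`, `shwSeq_T_sq_le` — first-hop decomposition + Cauchy–Schwarz:
  `T(Φ,v)² ≤ (1 + #hops(v)) (1 + ∑_{hops (c,p,q)} T_{∖c}(Φ, u_{cq})²)`;
* `shwSeq_card_hops_le`, `shwSeq_card_hops_le_off` — `#hops(v) ≤ k·deg(v)`, and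
  `≤ k² + k·deg_{≠c}(v)`;
* `shwSeq_sum_slot_indicator`, `shwSeq_card_pair_mul_le` — `#{Φ : slot holds v} = N/n`,
  `#{y : (y p).1 = v ∧ (y q).1 = u}·n² ≤ #clauses-contents` (`v ≠ u`);
* `shwSeq_T_erase_update`, `shwSeq_sum_clause_factor` — the avoiding cone is blind to the avoided
  clause; clause factorisation;
* `shwSeq_slot_exchange_T` — exchange bound: conditioning on a slot holding the label `v < u`
  costs the avoiding cone of `u` at most the factor `1/n`;
* `shwSeq_termB_u` — the conditioned, weighted second moment of one hop:
  `∑_Φ [Φcp = v, Φcq = u] (1 + #hops(v)) T_{∖c}(Φ,u)² ≤ (1 + k² + mk²/n)/n² · ∑_Φ T(Φ,u)²`.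
No definitions; axioms `propext`, `Classical.choice`, `Quot.sound`.
-/

set_option linter.dupNamespace false -- `Summit.PneNP.PneNP.…`: summit = sub-problem (D-0017)

namespace Summit.PneNP.PneNP.Theorems

open Finset
open scoped Classical

section SeqPrep

variable {m k n : ℕ}

/-! ### First hop + Cauchy–Schwarz -/

/-- The increasing cone of `v` is `{v}` plus the avoiding cones behind the hops from `v`. -/
theorem shwSeq_cone_subset (Φ : (Fin m → Fin k → Fin n × Bool)) (v : Fin n) :
    ((Finset.univ : Finset (Fin n)).filter fun ww =>
        (∃ (ll : ℕ) (xx : ℕ → Fin n), xx 0 = v ∧ xx ll = ww ∧ ∀ ss : ℕ, ss < ll →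
          (xx ss < xx (ss + 1) ∧ ∃ cc ∈ (Finset.univ : Finset (Fin m)), ∃ pp qq : Fin k,
            (Φ cc pp).1 = xx ss ∧ (Φ cc qq).1 = xx (ss + 1)))) ⊆
      {v} ∪ (((Finset.univ : Finset (Fin m × Fin k × Fin k)).filter fun tt =>
          (Φ tt.1 tt.2.1).1 = v ∧ v < (Φ tt.1 tt.2.2).1)).biUnion fun tt => (Finset.univ : Finset (Fin n)).filter fun ww =>
        (∃ (ll : ℕ) (xx : ℕ → Fin n), xx 0 = ((Φ tt.1 tt.2.2).1) ∧ xx ll = ww ∧ ∀ ss : ℕ, ss < ll →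
          (xx ss < xx (ss + 1) ∧ ∃ cc ∈ ((Finset.univ : Finset (Fin m)).erase tt.1), ∃ pp qq : Fin k,
            (Φ cc pp).1 = xx ss ∧ (Φ cc qq).1 = xx (ss + 1))) := by
  intro w hw
  rw [Finset.mem_filter] at hw
  rcases shwSeq_reach_cases Φ _ v w hw.2 with hwv | ⟨c, _, p, q, hp, hlt, hreach⟩
  · exact Finset.mem_union_left _ (Finset.mem_singleton.2 hwv)
  · refine Finset.mem_union_right _ (Finset.mem_biUnion.2 ⟨(c, p, q), ?_, ?_⟩)
    · exact Finset.mem_filter.2 ⟨Finset.mem_univ _, hp, hlt⟩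
    · exact Finset.mem_filter.2 ⟨Finset.mem_univ _, hreach⟩

/-- `T(Φ,v) ≤ 1 + ∑_{hops (c,p,q)} T_{∖c}(Φ, u_{cq})`. -/
theorem shwSeq_T_le_one_add_sum (Φ : (Fin m → Fin k → Fin n × Bool)) (v : Fin n) :
    ((((Finset.univ : Finset (Fin n)).filter fun ww => (∃ (ll : ℕ) (xx : ℕ → Fin n), xx 0 = v ∧ xx ll = ww ∧ ∀ ss : ℕ, ss < ll →
          (xx ss < xx (ss + 1) ∧ ∃ cc ∈ (Finset.univ : Finset (Fin m)), ∃ pp qq : Fin k,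
            (Φ cc pp).1 = xx ss ∧ (Φ cc qq).1 = xx (ss + 1)))).card : ℕ) : ℝ) ≤
      1 + ∑ tt ∈ ((Finset.univ : Finset (Fin m × Fin k × Fin k)).filter fun tt =>
          (Φ tt.1 tt.2.1).1 = v ∧ v < (Φ tt.1 tt.2.2).1),
        ((((Finset.univ : Finset (Fin n)).filter fun ww => (∃ (ll : ℕ) (xx : ℕ → Fin n), xx 0 = ((Φ tt.1 tt.2.2).1) ∧ xx ll = ww ∧ ∀ ss : ℕ, ss < ll →
          (xx ss < xx (ss + 1) ∧ ∃ cc ∈ ((Finset.univ : Finset (Fin m)).erase tt.1), ∃ pp qq : Fin k,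
            (Φ cc pp).1 = xx ss ∧ (Φ cc qq).1 = xx (ss + 1)))).card : ℕ) : ℝ) := by
  have h := Finset.card_le_card (shwSeq_cone_subset Φ v)
  have h2 := (h.trans (Finset.card_union_le _ _)).trans
    (Nat.add_le_add_left Finset.card_biUnion_le _)
  rw [Finset.card_singleton] at h2
  exact_mod_cast h2

/-- `T(Φ,v)² ≤ (1 + #hops(v))·(1 + ∑_{hops (c,p,q)} T_{∖c}(Φ, u_{cq})²)` (Cauchy–Schwarz). -/
theorem shwSeq_T_sq_le (Φ : (Fin m → Fin k → Fin n × Bool)) (v : Fin n) :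
    ((((Finset.univ : Finset (Fin n)).filter fun ww => (∃ (ll : ℕ) (xx : ℕ → Fin n), xx 0 = v ∧ xx ll = ww ∧ ∀ ss : ℕ, ss < ll →
          (xx ss < xx (ss + 1) ∧ ∃ cc ∈ (Finset.univ : Finset (Fin m)), ∃ pp qq : Fin k,
            (Φ cc pp).1 = xx ss ∧ (Φ cc qq).1 = xx (ss + 1)))).card : ℕ) : ℝ) ^ 2 ≤
      (1 + ((((Finset.univ : Finset (Fin m × Fin k × Fin k)).filter fun tt =>
          (Φ tt.1 tt.2.1).1 = v ∧ v < (Φ tt.1 tt.2.2).1)).card : ℝ)) * (1 + ∑ tt ∈ ((Finset.univ : Finset (Fin m × Fin k × Fin k)).filter fun tt =>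
          (Φ tt.1 tt.2.1).1 = v ∧ v < (Φ tt.1 tt.2.2).1),
        ((((Finset.univ : Finset (Fin n)).filter fun ww => (∃ (ll : ℕ) (xx : ℕ → Fin n), xx 0 = ((Φ tt.1 tt.2.2).1) ∧ xx ll = ww ∧ ∀ ss : ℕ, ss < ll →
          (xx ss < xx (ss + 1) ∧ ∃ cc ∈ ((Finset.univ : Finset (Fin m)).erase tt.1), ∃ pp qq : Fin k,
            (Φ cc pp).1 = xx ss ∧ (Φ cc qq).1 = xx (ss + 1)))).card : ℕ) : ℝ) ^ 2) := by
  have h1 := shwSeq_T_le_one_add_sum Φ v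
  have h0 : (0 : ℝ) ≤ ((((Finset.univ : Finset (Fin n)).filter fun ww => (∃ (ll : ℕ) (xx : ℕ → Fin n), xx 0 = v ∧ xx ll = ww ∧ ∀ ss : ℕ, ss < ll →
          (xx ss < xx (ss + 1) ∧ ∃ cc ∈ (Finset.univ : Finset (Fin m)), ∃ pp qq : Fin k,
            (Φ cc pp).1 = xx ss ∧ (Φ cc qq).1 = xx (ss + 1)))).card : ℕ) : ℝ) := Nat.cast_nonneg _
  exact (pow_le_pow_left₀ h0 h1 2).trans (shwSeq_sq_one_add_sum_le _ _)

/-! ### Counting hops -/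

/-- `#hops(v) ≤ k · deg(v)` (slot-degree of `v`). -/
theorem shwSeq_card_hops_le (Φ : (Fin m → Fin k → Fin n × Bool)) (v : Fin n) :
    (((Finset.univ : Finset (Fin m × Fin k × Fin k)).filter fun tt =>
          (Φ tt.1 tt.2.1).1 = v ∧ v < (Φ tt.1 tt.2.2).1)).card ≤
      k * ((Finset.univ : Finset (Fin m × Fin k)).filter fun cp => (Φ cp.1 cp.2).1 = v).card := by
  set D := (Finset.univ : Finset (Fin m × Fin k)).filter fun cp => (Φ cp.1 cp.2).1 = v with hD
  have hsub : ((Finset.univ : Finset (Fin m × Fin k × Fin k)).filter fun tt =>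
          (Φ tt.1 tt.2.1).1 = v ∧ v < (Φ tt.1 tt.2.2).1) ⊆ (D ×ˢ (Finset.univ : Finset (Fin k))).image
      fun x => (x.1.1, x.1.2, x.2) := by
    intro tt htt
    rw [Finset.mem_filter] at htt
    rw [Finset.mem_image]
    refine ⟨((tt.1, tt.2.1), tt.2.2), ?_, ?_⟩
    · rw [Finset.mem_product]
      exact ⟨Finset.mem_filter.2 ⟨Finset.mem_univ _, htt.2.1⟩, Finset.mem_univ _⟩
    · rfl
  calc (((Finset.univ : Finset (Fin m × Fin k × Fin k)).filter fun tt =>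
          (Φ tt.1 tt.2.1).1 = v ∧ v < (Φ tt.1 tt.2.2).1)).card ≤ _ := Finset.card_le_card hsub
    _ ≤ (D ×ˢ (Finset.univ : Finset (Fin k))).card := Finset.card_image_le
    _ = k * D.card := by rw [Finset.card_product, Finset.card_univ, Fintype.card_fin, mul_comm]

/-- `#hops(v) ≤ k² + k · deg_{≠c}(v)`. -/
theorem shwSeq_card_hops_le_off (Φ : (Fin m → Fin k → Fin n × Bool)) (v : Fin n) (c : Fin m) :
    (((Finset.univ : Finset (Fin m × Fin k × Fin k)).filter fun tt =>
          (Φ tt.1 tt.2.1).1 = v ∧ v < (Φ tt.1 tt.2.2).1)).card ≤ k * k +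
      k * ((Finset.univ : Finset (Fin m × Fin k)).filter fun cp =>
        cp.1 ≠ c ∧ (Φ cp.1 cp.2).1 = v).card := by
  set H := ((Finset.univ : Finset (Fin m × Fin k × Fin k)).filter fun tt =>
          (Φ tt.1 tt.2.1).1 = v ∧ v < (Φ tt.1 tt.2.2).1) with hH
  set D := (Finset.univ : Finset (Fin m × Fin k)).filter fun cp => cp.1 ≠ c ∧ (Φ cp.1 cp.2).1 = v
    with hD
  rw [← Finset.card_filter_add_card_filter_not (fun tt : Fin m × Fin k × Fin k => tt.1 = c)]
  refine Nat.add_le_add ?_ ?_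
  · have hsub : H.filter (fun tt => tt.1 = c) ⊆
        (Finset.univ : Finset (Fin k × Fin k)).image fun pq => (c, pq.1, pq.2) := by
      intro tt htt
      rw [Finset.mem_filter] at htt
      rw [Finset.mem_image]
      exact ⟨(tt.2.1, tt.2.2), Finset.mem_univ _, by rw [← htt.2]⟩
    calc (H.filter fun tt => tt.1 = c).card ≤ _ := Finset.card_le_card hsub
      _ ≤ (Finset.univ : Finset (Fin k × Fin k)).card := Finset.card_image_le
      _ = k * k := by rw [Finset.card_univ, Fintype.card_prod, Fintype.card_fin]
  · have hsub : H.filter (fun tt => ¬ tt.1 = c) ⊆ (D ×ˢ (Finset.univ : Finset (Fin k))).image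
        fun x => (x.1.1, x.1.2, x.2) := by
      intro tt htt
      rw [Finset.mem_filter, hH, Finset.mem_filter] at htt
      rw [Finset.mem_image]
      refine ⟨((tt.1, tt.2.1), tt.2.2), ?_, ?_⟩
      · rw [Finset.mem_product]
        exact ⟨Finset.mem_filter.2 ⟨Finset.mem_univ _, htt.2, htt.1.2.1⟩, Finset.mem_univ _⟩
      · rfl
    calc (H.filter fun tt => ¬ tt.1 = c).card ≤ _ := Finset.card_le_card hsub
      _ ≤ (D ×ˢ (Finset.univ : Finset (Fin k))).card := Finset.card_image_le
      _ = k * D.card := by rw [Finset.card_product, Finset.card_univ, Fintype.card_fin, mul_comm]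

/-! ### Lens laws for clauses and slots, and the basic counts -/

/-- Two literals carry a given variable. -/
theorem shwSeq_card_lit_fst (v : Fin n) :
    ((Finset.univ : Finset (Fin n × Bool)).filter fun ℓ => ℓ.1 = v).card = 2 := by
  have : ((Finset.univ : Finset (Fin n × Bool)).filter fun ℓ => ℓ.1 = v) =
      ({v} : Finset (Fin n)) ×ˢ (Finset.univ : Finset Bool) := by
    ext ℓ
    simp only [Finset.mem_filter, Finset.mem_univ, true_and, Finset.mem_product,
      Finset.mem_singleton, and_true]
  rw [this, Finset.card_product, Finset.card_singleton, Finset.card_univ, Fintype.card_bool]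

/-- `shwSeq_lens_exchange` with the ambient decidability instances (use-site form). -/
theorem shwSeq_lens_exchange' {S X : Type*} [Fintype S] [Fintype X] (ρ : S → X) (υ : S → X → S)
    (h1 : ∀ s x, ρ (υ s x) = x) (h2 : ∀ s x x', υ (υ s x) x' = υ s x')
    (h3 : ∀ s, υ s (ρ s) = s) (P : X → Prop) [DecidablePred P] (G : S → ℝ)
    (hmono : ∀ s, P (ρ s) → ∀ x, G s ≤ G (υ s x)) :
    (Fintype.card X : ℝ) * ∑ s ∈ (univ : Finset S).filter (fun s => P (ρ s)), G s ≤
      (((univ : Finset X).filter P).card : ℝ) * ∑ s, G s := by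
  convert shwSeq_lens_exchange ρ υ h1 h2 h3 P G hmono

/-- Slot lens, law 1. -/
theorem shwSeq_slot_read_write (Φ : (Fin m → Fin k → Fin n × Bool)) (c : Fin m) (j : Fin k) (ℓ : Fin n × Bool) :
    (Function.update Φ c (Function.update (Φ c) j ℓ)) c j = ℓ := by
  simp

/-- Slot lens, law 2. -/
theorem shwSeq_slot_write_write (Φ : (Fin m → Fin k → Fin n × Bool)) (c : Fin m) (j : Fin k) (ℓ ℓ' : Fin n × Bool) :
    Function.update (Function.update Φ c (Function.update (Φ c) j ℓ)) c
        (Function.update ((Function.update Φ c (Function.update (Φ c) j ℓ)) c) j ℓ') =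
      Function.update Φ c (Function.update (Φ c) j ℓ') := by
  simp only [Function.update_self, Function.update_idem]

/-- Slot lens, law 3. -/
theorem shwSeq_slot_write_read (Φ : (Fin m → Fin k → Fin n × Bool)) (c : Fin m) (j : Fin k) :
    Function.update Φ c (Function.update (Φ c) j (Φ c j)) = Φ := by
  simp only [Function.update_eq_self]

/-- `#{Φ : slot (c,j) holds v} = N/n`, as a weighted identity: for any `G` blind to the slot,
`n · ∑_{(Φ c j).1 = v} G = ∑_Φ G`. -/
theorem shwSeq_sum_slot_indicator (c : Fin m) (j : Fin k) (v : Fin n) (G : (Fin m → Fin k → Fin n × Bool) → ℝ)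
    (hG : ∀ (Φ : (Fin m → Fin k → Fin n × Bool)) (ℓ : Fin n × Bool), G (Function.update Φ c (Function.update (Φ c) j ℓ)) = G Φ) :
    (n : ℝ) * ∑ Φ ∈ (Finset.univ : Finset (Fin m → Fin k → Fin n × Bool)).filter (fun Φ => (Φ c j).1 = v), G Φ =
      ∑ Φ : (Fin m → Fin k → Fin n × Bool), G Φ := by
  have h := shwSeq_lens_sum_mul (S := (Fin m → Fin k → Fin n × Bool)) (X := Fin n × Bool) (fun Φ => Φ c j)
    (fun Φ ℓ => Function.update Φ c (Function.update (Φ c) j ℓ))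
    (fun Φ ℓ => shwSeq_slot_read_write Φ c j ℓ) (fun Φ ℓ ℓ' => shwSeq_slot_write_write Φ c j ℓ ℓ')
    (fun Φ => shwSeq_slot_write_read Φ c j) (fun ℓ => if ℓ.1 = v then 1 else 0) G hG
  rw [Fintype.card_prod, Fintype.card_fin, Fintype.card_bool] at h
  have hw : ∑ ℓ : Fin n × Bool, (if ℓ.1 = v then (1 : ℝ) else 0) = 2 := by
    rw [Finset.sum_boole, shwSeq_card_lit_fst v]; norm_num
  rw [hw] at h
  have hs : ∑ Φ : (Fin m → Fin k → Fin n × Bool), (if (Φ c j).1 = v then (1 : ℝ) else 0) * G Φ =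
      ∑ Φ ∈ (Finset.univ : Finset (Fin m → Fin k → Fin n × Bool)).filter (fun Φ => (Φ c j).1 = v), G Φ := by
    rw [Finset.sum_filter]
    refine Finset.sum_congr rfl fun Φ _ => ?_
    split_ifs <;> simp
  rw [hs] at h
  push_cast at h
  linarith

/-- In one clause, prescribing the variables of two slots costs `n²`:
`#{y : (y p).1 = v ∧ (y q).1 = u} · n² ≤ #(Fin k → Fin n × Bool)` for `v ≠ u`. -/
theorem shwSeq_card_pair_mul_le (p q : Fin k) (v u : Fin n) (hvu : v ≠ u) :
    ((((Finset.univ : Finset (Fin k → Fin n × Bool)).filter fun y =>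
        (y p).1 = v ∧ (y q).1 = u).card : ℕ) : ℝ) * (n : ℝ) ^ 2 ≤
      Fintype.card (Fin k → Fin n × Bool) := by
  by_cases hpq : p = q
  · subst hpq
    have h0 : ((Finset.univ : Finset (Fin k → Fin n × Bool)).filter fun y =>
        (y p).1 = v ∧ (y p).1 = u) = ∅ := by
      rw [Finset.filter_eq_empty_iff]
      rintro y - ⟨h1, h2⟩
      exact hvu (h1.symm.trans h2)
    rw [h0, Finset.card_empty, Nat.cast_zero, zero_mul]
    exact Nat.cast_nonneg _
  · -- lens at coordinate `p`, then at coordinate `q`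
    have hqp : q ≠ p := fun h => hpq h.symm
    have hA := shwSeq_lens_sum_mul (S := Fin k → Fin n × Bool) (X := Fin n × Bool) (fun y => y p)
      (fun y ℓ => Function.update y p ℓ) (fun y ℓ => by simp) (fun y ℓ ℓ' => by simp)
      (fun y => by simp) (fun ℓ => if ℓ.1 = v then 1 else 0)
      (fun y => if (y q).1 = u then 1 else 0)
      (fun y ℓ => by simp only [Function.update_of_ne hqp])
    have hB := shwSeq_lens_sum_mul (S := Fin k → Fin n × Bool) (X := Fin n × Bool) (fun y => y q)
      (fun y ℓ => Function.update y q ℓ) (fun y ℓ => by simp) (fun y ℓ ℓ' => by simp)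
      (fun y => by simp) (fun ℓ => if ℓ.1 = u then 1 else 0) (fun _ => (1 : ℝ)) (fun y ℓ => rfl)
    rw [Fintype.card_prod, Fintype.card_fin, Fintype.card_bool] at hA hB
    have hwv : ∑ ℓ : Fin n × Bool, (if ℓ.1 = v then (1 : ℝ) else 0) = 2 := by
      rw [Finset.sum_boole, shwSeq_card_lit_fst v]; norm_num
    have hwu : ∑ ℓ : Fin n × Bool, (if ℓ.1 = u then (1 : ℝ) else 0) = 2 := by
      rw [Finset.sum_boole, shwSeq_card_lit_fst u]; norm_num
    rw [hwv] at hA; rw [hwu] at hB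
    simp only [mul_one] at hB
    have hcard : ∑ _y : Fin k → Fin n × Bool, (1 : ℝ) = Fintype.card (Fin k → Fin n × Bool) := by
      rw [Finset.sum_const, Finset.card_univ, nsmul_eq_mul, mul_one]
    rw [hcard] at hB
    have hpair : ∑ y : Fin k → Fin n × Bool,
        (if (y p).1 = v then (1 : ℝ) else 0) * (if (y q).1 = u then 1 else 0) =
        ((((Finset.univ : Finset (Fin k → Fin n × Bool)).filter fun y =>
          (y p).1 = v ∧ (y q).1 = u).card : ℕ) : ℝ) := by
      rw [Finset.natCast_card_filter]
      refine Finset.sum_congr rfl fun y _ => ?_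
      by_cases h1 : (y p).1 = v <;> by_cases h2 : (y q).1 = u <;> simp [h1, h2]
    rw [hpair] at hA
    push_cast at hA hB
    -- `(2n)·#pair = 2·#{q-fibre}` and `(2n)·#{q-fibre} = 2·card`
    have hn0 : (0 : ℝ) ≤ n := Nat.cast_nonneg _
    nlinarith [hA, hB, hn0]

/-! ### The avoiding cone is blind to the avoided clause -/

/-- `T_{∖c}(Φ[c ↦ y], u) = T_{∖c}(Φ, u)`. -/
theorem shwSeq_T_erase_update (Φ : (Fin m → Fin k → Fin n × Bool)) (c : Fin m) (y : Fin k → Fin n × Bool) (u : Fin n) :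
    ((Finset.univ : Finset (Fin n)).filter fun ww => (∃ (ll : ℕ) (xx : ℕ → Fin n), xx 0 = u ∧ xx ll = ww ∧ ∀ ss : ℕ, ss < ll →
          (xx ss < xx (ss + 1) ∧ ∃ cc ∈ ((Finset.univ : Finset (Fin m)).erase c), ∃ pp qq : Fin k,
            ((Function.update Φ c y) cc pp).1 = xx ss ∧ ((Function.update Φ c y) cc qq).1 = xx (ss + 1)))).card =
      ((Finset.univ : Finset (Fin n)).filter fun ww => (∃ (ll : ℕ) (xx : ℕ → Fin n), xx 0 = u ∧ xx ll = ww ∧ ∀ ss : ℕ, ss < ll →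
          (xx ss < xx (ss + 1) ∧ ∃ cc ∈ ((Finset.univ : Finset (Fin m)).erase c), ∃ pp qq : Fin k,
            (Φ cc pp).1 = xx ss ∧ (Φ cc qq).1 = xx (ss + 1)))).card := by
  have hoff : ∀ c' ∈ (Finset.univ : Finset (Fin m)).erase c, (Function.update Φ c y) c' = Φ c' :=
    fun c' hc' => Function.update_of_ne (Finset.ne_of_mem_erase hc') _ _
  have hoff' : ∀ c' ∈ (Finset.univ : Finset (Fin m)).erase c, Φ c' = (Function.update Φ c y) c' :=
    fun c' hc' => (hoff c' hc').symm
  congr 1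
  ext w
  simp only [Finset.mem_filter, Finset.mem_univ, true_and]
  exact ⟨fun h => shwSeq_reach_congr _ _ _ hoff' u w h, fun h => shwSeq_reach_congr _ _ _ hoff u w h⟩

/-- `deg_{≠c}(v)` is blind to clause `c`. -/
theorem shwSeq_degoff_update (Φ : (Fin m → Fin k → Fin n × Bool)) (c : Fin m) (y : Fin k → Fin n × Bool) (v : Fin n) :
    ((Finset.univ : Finset (Fin m × Fin k)).filter fun cp =>
        cp.1 ≠ c ∧ ((Function.update Φ c y) cp.1 cp.2).1 = v) =
      ((Finset.univ : Finset (Fin m × Fin k)).filter fun cp => cp.1 ≠ c ∧ (Φ cp.1 cp.2).1 = v) := by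
  ext cp
  simp only [Finset.mem_filter, Finset.mem_univ, true_and]
  constructor
  · rintro ⟨h1, h2⟩; exact ⟨h1, by rwa [Function.update_of_ne h1] at h2⟩
  · rintro ⟨h1, h2⟩; exact ⟨h1, by rwa [Function.update_of_ne h1]⟩

/-- **Clause factorisation.** For `G` blind to clause `c`,
`#(Fin k → Fin n × Bool) · ∑_Φ w(Φ c) G(Φ) = (∑_y w y) · ∑_Φ G(Φ)`. -/
theorem shwSeq_sum_clause_factor (c : Fin m) (w : (Fin k → Fin n × Bool) → ℝ) (G : (Fin m → Fin k → Fin n × Bool) → ℝ)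
    (hG : ∀ (Φ : (Fin m → Fin k → Fin n × Bool)) (y : Fin k → Fin n × Bool), G (Function.update Φ c y) = G Φ) :
    (Fintype.card (Fin k → Fin n × Bool) : ℝ) * ∑ Φ : (Fin m → Fin k → Fin n × Bool), w (Φ c) * G Φ =
      (∑ y : Fin k → Fin n × Bool, w y) * ∑ Φ : (Fin m → Fin k → Fin n × Bool), G Φ :=
  shwSeq_lens_sum_mul (S := (Fin m → Fin k → Fin n × Bool)) (X := Fin k → Fin n × Bool) (fun Φ => Φ c)
    (fun Φ y => Function.update Φ c y) (fun Φ y => by simp) (fun Φ y y' => by simp)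
    (fun Φ => by simp) w G hG

/-! ### Exchange bound for the avoiding cone -/

/-- **Exchange.** For `v < u` and any slot `(c', j)`:
`n · ∑_{(Φ c' j).1 = v} T_{∖c}(Φ, u)² ≤ ∑_Φ T_{∖c}(Φ, u)²`
(chains from `u` never read a slot holding `v`, so rewriting it only adds chains). -/
theorem shwSeq_slot_exchange_T (v u : Fin n) (hvu : v < u) (c c' : Fin m) (j : Fin k) :
    (n : ℝ) * ∑ Φ ∈ (Finset.univ : Finset (Fin m → Fin k → Fin n × Bool)).filter (fun Φ => (Φ c' j).1 = v),
        ((((Finset.univ : Finset (Fin n)).filter fun ww => (∃ (ll : ℕ) (xx : ℕ → Fin n), xx 0 = u ∧ xx ll = ww ∧ ∀ ss : ℕ, ss < ll →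
          (xx ss < xx (ss + 1) ∧ ∃ cc ∈ ((Finset.univ : Finset (Fin m)).erase c), ∃ pp qq : Fin k,
            (Φ cc pp).1 = xx ss ∧ (Φ cc qq).1 = xx (ss + 1)))).card : ℕ) : ℝ) ^ 2 ≤
      ∑ Φ : (Fin m → Fin k → Fin n × Bool), ((((Finset.univ : Finset (Fin n)).filter fun ww => (∃ (ll : ℕ) (xx : ℕ → Fin n), xx 0 = u ∧ xx ll = ww ∧ ∀ ss : ℕ, ss < ll →
          (xx ss < xx (ss + 1) ∧ ∃ cc ∈ ((Finset.univ : Finset (Fin m)).erase c), ∃ pp qq : Fin k,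
            (Φ cc pp).1 = xx ss ∧ (Φ cc qq).1 = xx (ss + 1)))).card : ℕ) : ℝ) ^ 2 := by
  have h := shwSeq_lens_exchange' (S := (Fin m → Fin k → Fin n × Bool)) (X := Fin n × Bool) (fun Φ => Φ c' j)
    (fun Φ ℓ => Function.update Φ c' (Function.update (Φ c') j ℓ))
    (fun Φ ℓ => shwSeq_slot_read_write Φ c' j ℓ) (fun Φ ℓ ℓ' => shwSeq_slot_write_write Φ c' j ℓ ℓ')
    (fun Φ => shwSeq_slot_write_read Φ c' j) (fun ℓ => ℓ.1 = v)
    (fun Φ => ((((Finset.univ : Finset (Fin n)).filter fun ww => (∃ (ll : ℕ) (xx : ℕ → Fin n), xx 0 = u ∧ xx ll = ww ∧ ∀ ss : ℕ, ss < ll →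
          (xx ss < xx (ss + 1) ∧ ∃ cc ∈ ((Finset.univ : Finset (Fin m)).erase c), ∃ pp qq : Fin k,
            (Φ cc pp).1 = xx ss ∧ (Φ cc qq).1 = xx (ss + 1)))).card : ℕ) : ℝ) ^ 2) ?_
  · rw [Fintype.card_prod, Fintype.card_fin, Fintype.card_bool, shwSeq_card_lit_fst v] at h
    push_cast at h
    linarith
  · intro Φ hΦ ℓ
    have hlt : (Φ c' j).1 < u := by rw [hΦ]; exact hvu
    have hsub : ((Finset.univ : Finset (Fin n)).filter fun ww =>
          (∃ (ll : ℕ) (xx : ℕ → Fin n), xx 0 = u ∧ xx ll = ww ∧ ∀ ss : ℕ, ss < ll →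
          (xx ss < xx (ss + 1) ∧ ∃ cc ∈ ((Finset.univ : Finset (Fin m)).erase c), ∃ pp qq : Fin k,
            (Φ cc pp).1 = xx ss ∧ (Φ cc qq).1 = xx (ss + 1)))) ⊆
        ((Finset.univ : Finset (Fin n)).filter fun ww =>
          (∃ (ll : ℕ) (xx : ℕ → Fin n), xx 0 = u ∧ xx ll = ww ∧ ∀ ss : ℕ, ss < ll →
          (xx ss < xx (ss + 1) ∧ ∃ cc ∈ ((Finset.univ : Finset (Fin m)).erase c), ∃ pp qq : Fin k,
            ((Function.update Φ c' (Function.update (Φ c') j ℓ)) cc pp).1 = xx ss ∧ ((Function.update Φ c' (Function.update (Φ c') j ℓ)) cc qq).1 = xx (ss + 1)))) := by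
      intro w hw
      rw [Finset.mem_filter] at hw ⊢
      exact ⟨hw.1, shwSeq_reach_update_slot Φ _ u w c' j ℓ hlt hw.2⟩
    have hle : (((((Finset.univ : Finset (Fin n)).filter fun ww => (∃ (ll : ℕ) (xx : ℕ → Fin n), xx 0 = u ∧ xx ll = ww ∧ ∀ ss : ℕ, ss < ll →
          (xx ss < xx (ss + 1) ∧ ∃ cc ∈ ((Finset.univ : Finset (Fin m)).erase c), ∃ pp qq : Fin k,
            (Φ cc pp).1 = xx ss ∧ (Φ cc qq).1 = xx (ss + 1)))).card : ℕ) : ℝ)) ≤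
        ((((Finset.univ : Finset (Fin n)).filter fun ww => (∃ (ll : ℕ) (xx : ℕ → Fin n), xx 0 = u ∧ xx ll = ww ∧ ∀ ss : ℕ, ss < ll →
          (xx ss < xx (ss + 1) ∧ ∃ cc ∈ ((Finset.univ : Finset (Fin m)).erase c), ∃ pp qq : Fin k,
            ((Function.update Φ c' (Function.update (Φ c') j ℓ)) cc pp).1 = xx ss ∧ ((Function.update Φ c' (Function.update (Φ c') j ℓ)) cc qq).1 = xx (ss + 1)))).card : ℕ) : ℝ) := by
      exact_mod_cast Finset.card_le_card hsub
    exact pow_le_pow_left₀ (Nat.cast_nonneg _) hle 2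

end SeqPrep

end Summit.PneNP.PneNP.Theorems
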